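import Literature.MathematicalPhysics.QuantumFieldTheory.Balaban1983to89.B9Thm39CinvFinalLocDefect
import Literature.MathematicalPhysics.QuantumFieldTheory.Balaban1983to89.B9Thm39CinvAtCoverAbove

/-!
# `Balaban1983to89.B9Thm39CinvAtCoverDefect` — [Balaban1985BackgroundPropagators] THEOREM 3.9 pp. 411–413 ⇒ THEOREM 3.2 (3.48) p. 398 FOR `C(U) = (Q′G′²Q′*)⁻¹(U)`
# AT THE CUBE COVER OF RECORD AND FOR EVERY MEMBER ABOVE ONE THRESHOLD, LOCAL-INVERSE LAW OF THE CUBE LETTERS UP TO A DISPLAYED DEFECT: FILE 10 §3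
# (`B9Thm39CinvAtCover`) and FILE 12 (`B9Thm39CinvAtCoverAbove`) re-run on E1-2 (cell `lit-balaban`, G-B9-LETTERS module M5.2-E ∕ M5.6, file E1-3, seat p21
# gen 34; design memo `lit-balaban-p21/M52E-DESIGN-p21.md` v1)

statement-level skeleton of published theorems with citation tags; proofs where landed; nothing here is a claim about the Yang–Mills mass gap

CITATION HEADER (lean-in-tree rule).  B9 = T. Bałaban, *Propagators for lattice gauge theories in a background field*, Commun. Math. Phys. **99** (1985)
389–434 (journal page = PDF page + 388).  p. 408 «We take the partition of unity {h_□} defined at the end of Sect. A in [4]. We have Σ_{□∈𝒟} h²_□ = 1. For a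
cube □ ∈ 𝒟_j and n = 1, 2,… we define □̃ⁿ as a cube of the size (2 + 2n)MLʲη, and with the same center as □»; p. 409 l. 2–5 («the operators constructed for this
sequence … C_□(U) = (Q′(U)G′²_□(U)Q′*(U))⁻¹»), (3.87); p. 411 (3.95)/(3.96); p. 412 (3.97) («e^{−2δ₀M} … (2δ₀M)⁻¹»); p. 413 Theorem 3.9 («For M sufficiently large …
This theorem implies Theorem 3.2»); Thm 3.1 (3.42) p. 397; Thm 3.2 (3.48) p. 398; p. 398 (scale transfer).  [4] = [Balaban1984PropagatorsII] (2.36) p. 229, Lemma 2.1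
(2.59)–(2.61), (2.63) pp. 233–234, (2.83)–(2.85) pp. 237–238.  Rows B9.Thm3.9 × B9.Thm3.2 × B9.Eq3.95 × B9.Eq3.87 (cells only; no row head changes).

WHY THIS FILE (M5.2-E, memo §3 E1-3).  E1-1/E1-2 re-ran module M5.6's (3.95)/(3.96) glue and its member-level end statement with the local-inverse law of the
cube letters `C_□` holding up to a displayed defect `E_□` (the FOURTH sum of `R` — an (R)-DESIGN TERM, NOT IN PRINT (cell GAPS `G-B9-p21-01`): print's `C_□` is [4] (2.79)–(2.82)'s inverse of the compression of
`□̃Q′G′(□̃)²Q′*□̃` to `𝔅 ∩ □̃` with the GLOBAL averaging `Q′` (p. 411 «in the same way as in (2.82) [4]»; map owner r06 first-hand on CMP 96 p. 237), for which (3.95)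
is an EXACT identity; the tree's cube letter of record `B9CubeLettersBondOpsL0.CCubeY` (lead RULING #5: the SEQUENCE-averaged full inverse `(Q′_□G′²_□Q′_□*)⁻¹` on the
cube sequence's own blocks, chosen to avoid inverse-of-compression decay at a general field; its averaging coincides with the member's on `NearH □ ⊇ supp h_□` only)
satisfies the law only up to the defect `h_□□̃Q′G′²_□(Q′* − Q′*_□)C_□h_□`, of size `e^{−O(δ₀M)}` = the order of print's own (3.97) factors (p. 412 l. 31–35); nothing fails
as printed).  THIS FILE carries the change through FILE 10 §3 (the cover of record: `h_□ := hB`, `χ_□ := 1_{□̃}`,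
`S_□ := □⁺`, `S^χ_□ := □̃`, `N := 3·5^{d+1}`, `D_sep := M/(2L²)`, `ℓ₀ := 0`, `ℓ₁ := 2s_T/M` — all FILE 10 §1–§2 facts USED BY NAME) and FILE 12 (every member above
ONE threshold, the geometry discharged by FILE 11) — verbatim, with `hloc ↦ hdef + hEd` and `θ₄ = 3·5^{d+1}κ_Ee^{−a_Xδ₀D_sep}`.

WHAT IS PROVED (all `theorem`s, 0 `def`, 0 sorry, 0 new named facts).  §1 ★★★ `hasMajorant_conj_XinvY_of_eBlockInv_cover_defect`, `norm_XinvY_apply_of_eBlockInv_cover_defect`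
(FILE 10 §3 twins);  §2 ★★★ `cinv_cover_above_defect` (FILE 12 twin: `∃ M_L d₂ d′, ∀ member above M_L`, geometry gone).

HONEST SCOPE / NOT CLAIMED.  Exactly FILES 10/12's scope with the local-inverse law weakened to «up to the displayed defect»: the fourth sum is the (R)-DESIGN
TERM above (not in print; E1-1 v1.1, GAPS `G-B9-p21-01`); DISPLAYED remain the `EBlock`s of `G′` and of the `G′_□` (M5.5 ∕ M5.1b-G′), the cube letters `C_□ = Cl □` with un-localized (3.48) blocks
`hC`, the defect law `hdef` and majorant `hEd` (M5.2-E supply), the LOCALIZED [2]-difference `hD` (cell GAPS G-B9-05 — NOT derived in the tree), `IsUnit XY`,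
contractive transporters, the rate bookkeeping and (here still) the located smallness — discharged in E1-4.  Sup-entry (3.48) only.  Finite 𝕋 member of the
k-level V1 family; constants explicit; nothing continuum, nothing about the mass gap; NOT summit progress.  RELATED, NOT DUPLICATED (searched 2026-08-28:
`lean search 'cover_defect|cover_above_defect' --decl` = ∅): FILES 10/12 (exact law; kept for their consumers), E1-1/E1-2.
-/

noncomputable section

namespace Literature.MathematicalPhysics.QuantumFieldTheory.Balaban1983to89.B9Thm39CinvAtCoverDefect

open Node00 B9CubeLettersInvReadings
open B6Geom246MultiLevelBox (bset blkOf)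
open B6Cover236MultiLevelBlocks (cubes)
open B6Cover236MultiLevelTorusBlocks (hB cubeIndT)
open B6Ineq2142KLevelV1 (β)
open B6KLevelCensusIndexV1 (KIdx)
open B6RandomWalk (HasMajorant Triangle254 Ineq261 Ineq263 hasMajorant_mono)
open B9Thm34Ext (toB6)
open B9FromB6 (EBlock)
open B9GeoNormsKLevelV1 (geo9K)
open B9GeoLemma21KLevelV1 (one_le_Mh one_le_P geo9K_M_nonneg)
open B9RWSums347DefiniteFaces (exp261)
open B9Eq352DivFormLetters (conj)
open B9Thm37CubeCoverCommutators (cutMulY)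
open B9Thm37CubeCoverCommutatorSizes (four_le_P')
open B9Thm37GpTorusRegularCubes (SQT hcnt_SQT)
open B9Ineq349SiteComposite (etaS_pos)
open B9Thm39CinvTorusRegular (norm_apply_le_of_hasMajorant_blk)
open B9Thm39CinvAtCover (SQbigT chiBigT DsepT lipT indicator_SQbigT_eq indicator_SQT_eq sum_hB_sq_blk abs_hB_le hS_cover hsep_cover hLip_cover geo9K_basic
  lipT_nonneg chiBigT_01 chiBigT_eq_one chiBigT_supp)
open B9Thm39CinvAtCoverAbove (size_of_threshold)
open B9GeoInputsMultiRateKLevelV1 (geo_inputs3_geo9K scaleTransfer_len_sq_geo9K scaleTransfer_len_inv4_geo9K)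
open B9Thm39CinvFinalLocDefect (hasMajorant_conj_XinvY_of_eBlockInv_loc_defect)

variable {d ℓ : ℕ} {hd : 1 ≤ d + 1} {hL : Odd (ℓ + 1) ∧ 1 < ℓ + 1} {b₀ b₁ : ℝ}
variable {𝔸 : Type} [NormedRing 𝔸] [NormedAlgebra ℂ 𝔸] [CompleteSpace 𝔸]
variable {ι : Type} [Fintype ι] [DecidableEq ι]

section Cover

variable (i : KIdx d ℓ hd hL b₀ b₁) (b : Module.Basis ι ℝ 𝔸)
variable [Fintype (geo9K i).Site] [DecidableEq (geo9K i).Site] {Rr : ℝ} {Hp : Prop}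

/-! ## §1 ★★★ Theorem 3.9 ⇒ Theorem 3.2 (3.48) for `C(U)` at the cube cover of record, local-inverse law up to the displayed defect (FILE 10 §3 twin) -/

section Main

variable {B : B9.Backgrounds} (cfg : B.Cfg → CfgY 𝔸 i) (O : SiteOpY 𝔸 i) (parS : SiteParY 𝔸 i) {U₁ : B.Cfg}
variable (ιB : BlkY i → IBondY i)

/-- ★★★ **THEOREM 3.9 ⇒ THEOREM 3.2 (3.48) FOR `C(U) = (Q′G′²Q′*)⁻¹(U)` AT THE CUBE COVER OF RECORD, FROM THEOREM 3.1's (3.42) BLOCKS OF `G′(U)` AND OF THE `G′_□(U)`**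
(FILE 9b `hasMajorant_conj_XinvY_of_eBlockInv_loc` with `h_□ := hB i.D □` — «We take the partition of unity {h_□} … Σh²_□ = 1», read on 𝔅 —, `χ_□ := 1_{□̃}`, `S_□ := □⁺`,
`S^χ_□ := □̃`, `N := 3·5^{d+1}`, `D_sep := M/(2L²)`, `ℓ₀ := 0`, `ℓ₁ := 2s_T/M`, `s := (η²η²)⁻¹`, and the four distance facts of `geo9K` discharged): from the `EBlock`s of
`G′ = O` and of every cube letter `G′_□ = Oc □` over the invariant class (M5.5), a section `ιB` of `β`, `IsUnit (XY i parS O U)`, contractive transporters, the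
coordinate bound `M₂` of `b`, the scale transfer of `ℓ²` at `α_G` with (2.61) at `((1−α_G)δ_G, α₂)`, the target rate `a_Lδ₀ ≦ (1−α₂)(1−α_G)δ_G`, the per-cube
local-inverse law UP TO THE DISPLAYED DEFECT (`hdef`, `hEd`; E1-1's fourth sum, `θ₄ = 3·5^{d+1}κ_Ee^{−a_Xδ₀D_sep}`) and (3.48) blocks `hC` of the `C_□ = Cl □` at `h_□`, `1_{□̃}`, the LOCALIZED [2]-difference majorants `hD` of
`conj b ((η²η²)•(M_{1_{□̃}}(XY G′ − XY G′_□)M_{1_{□⁺}}))` (GAP G-B9-05), the scale transfer of `ℓ⁻⁴` at `α_st`, (2.61) at `(δ₀, b−ρ)`, (2.61)/(2.63) at `(ρδ₀, α′)`,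
the exponent splits and the located smallness `(θ₁+θ₂+θ₃+θ₄)c₁(ρδ₀, α′) < 1` («M sufficiently large») ⟹
`conj b ((η²η²)⁻¹•(XinvY i parS O U)) ≺ 3·5^{d+1}·B₀·c₁(ρδ₀,α′)(1 − (θ₁+θ₂+θ₃+θ₄)c₁(ρδ₀,α′))⁻¹·ℓ(a)⁻⁴·e^{−(1−α′)ρδ₀d(a,a′)}` on the block carrier `(t, j) ↦ ιB t`.
[cite: Balaban1985BackgroundPropagators, Thm 3.9 p.413 + (3.95)–(3.97) pp.411–412 + (3.87) p.409 + p.408 + Thm 3.1 (3.42) p.397 + Thm 3.2 (3.48) p.398;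
Balaban1984PropagatorsII, (2.36) p.229 + Lemma 2.1 p.234 + (2.83)–(2.85) pp.237–238] -/
theorem hasMajorant_conj_XinvY_of_eBlockInv_cover_defect (Oc : ↥(cubes i.D.toDomains) → SiteOpY 𝔸 i)
    {BG δG : ℝ} (hE : EBlock (kernelFamilySInv i B cfg O parS) BG δG U₁) (hEc : ∀ c, EBlock (kernelFamilySInv i B cfg (Oc c) parS) BG δG U₁)
    (hBG : 0 ≤ BG) (hι : ∀ s, β i.hN i.D i.hk (ιB s) = s)
    (hunit : IsUnit (XY i parS O (cfg U₁)))
    (hpar : ∀ z w : SiteY i, ‖(parS (cfg U₁) z w : 𝔸)‖ ≤ 1 ∧ ‖(((parS (cfg U₁) z w)⁻¹ : 𝔸ˣ) : 𝔸)‖ ≤ 1)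
    {M₂ : ℝ} (hM₂ : 0 ≤ M₂) (hrepr : ∀ (v : 𝔸) (j : ι), |b.repr v j| ≤ M₂ * ‖v‖) (d' d₂ : ℕ)
    {αG α₂ CG : ℝ} (hCG : 0 ≤ CG) (hαGδ : 0 ≤ αG * δG) (hα₂0 : 0 ≤ α₂) (hα₂1 : α₂ ≤ 1) (hδG : 0 ≤ (1 - αG) * δG)
    (hSTG : B9Ineq347.ScaleTransfer (geo9K i) δG αG CG (fun a => (geo9K i).len a ^ 2))
    (h261G : Ineq261 d₂ (toB6 (geo9K i) Rr Hp) ((1 - αG) * δG) α₂)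
    {δ₀ aL aD aE aX αc αst asep ρ bb κG κD κE B₀ C α' θ₁ θ₂ θ₃ θ₄ : ℝ} (hrate : aL * δ₀ ≤ (1 - α₂) * ((1 - αG) * δG))
    (Cl E : ↥(cubes i.D.toDomains) → Module.End ℝ (BlkY i → 𝔸))
    (hκD : 0 ≤ κD) (hκE : 0 ≤ κE) (hB₀ : 0 ≤ B₀) (hC0 : 0 ≤ C)
    (hδ₀ : 0 ≤ δ₀) (hasep : 0 ≤ asep) (hρ : 0 ≤ ρ) (hρb : ρ ≤ bb) (hρE : ρ ≤ aE) (hαc : 0 < αc * δ₀) (hα'1 : α' ≤ 1)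
    (hsplit₁ : αst + asep + ρ ≤ aL) (hsplit₂ : αst + ρ ≤ aD) (hsplit₃ : αst + αc + ρ ≤ aL)
    (hκG : κG = (M₂ * (∑ j, ‖b j‖) * BG) ^ 2 * CG * B6.c1 d₂ ((1 - αG) * δG) α₂)
    (hθ₁ : θ₁ = (3 * 5 ^ (d + 1)) * (((M₂ * ∑ j, ‖b j‖) ^ 2 * κG) * B₀ * C * B6.c1 d' δ₀ (bb - ρ) * Real.exp (-(asep * δ₀ * DsepT i))))
    (hθ₂ : θ₂ = (3 * 5 ^ (d + 1)) * (κD * Real.exp (-(2 * δ₀ * DsepT i)) * B₀ * C * B6.c1 d' δ₀ (bb - ρ)))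
    (hθ₃ : θ₃ = (3 * 5 ^ (d + 1)) * ((lipT i * (αc * δ₀)⁻¹) * ((M₂ * ∑ j, ‖b j‖) ^ 2 * κG) * B₀ * C * B6.c1 d' δ₀ (bb - ρ)))
    (hθ₄ : θ₄ = (3 * 5 ^ (d + 1)) * (κE * Real.exp (-(aX * δ₀ * DsepT i))))
    (hST : B9Ineq347.ScaleTransfer (geo9K i) δ₀ αst C (fun a => ((geo9K i).len a ^ 4)⁻¹)) (h261b : Ineq261 d' (toB6 (geo9K i) Rr Hp) δ₀ (bb - ρ))
    (h261 : Ineq261 d' (toB6 (geo9K i) Rr Hp) (ρ * δ₀) α') (h263 : Ineq263 d' (toB6 (geo9K i) Rr Hp) (ρ * δ₀) α')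
    (hsmall : (θ₁ + θ₂ + θ₃ + θ₄) * B6.c1 d' (ρ * δ₀) α' < 1)
    (hdef : ∀ c, (cutMulY (𝔸 := 𝔸) (hB i.D c)).restrictScalars ℝ *
      ((cutMulY (𝔸 := 𝔸) (chiBigT i c)).restrictScalars ℝ * (XY i parS (Oc c) (cfg U₁)).restrictScalars ℝ) * Cl c *
        (cutMulY (𝔸 := 𝔸) (hB i.D c)).restrictScalars ℝ =
      (cutMulY (𝔸 := 𝔸) (hB i.D c)).restrictScalars ℝ * (cutMulY (𝔸 := 𝔸) (hB i.D c)).restrictScalars ℝ + E c)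
    (hC : ∀ c, HasMajorant (g := toB6 (geo9K i) Rr Hp) (fun p : BlkY i × ι => ιB p.1) (conj b ((etaS i ^ 2 * etaS i ^ 2)⁻¹ • Cl c))
      (fun a a' => B₀ * ((geo9K i).len a ^ 4)⁻¹ * Real.exp (-(bb * δ₀ * (geo9K i).dist a a'))))
    (hD : ∀ c, HasMajorant (g := toB6 (geo9K i) Rr Hp) (fun p : BlkY i × ι => ιB p.1)
      (conj b ((etaS i ^ 2 * etaS i ^ 2) • ((cutMulY (𝔸 := 𝔸) (chiBigT i c)).restrictScalars ℝ *
        ((XY i parS O (cfg U₁)).restrictScalars ℝ - (XY i parS (Oc c) (cfg U₁)).restrictScalars ℝ) *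
        (cutMulY (𝔸 := 𝔸) (cubeIndT i.D (one_le_Mh i) (four_le_P' i) c)).restrictScalars ℝ)))
      (fun a a'' => κD * Real.exp (-(2 * δ₀ * DsepT i)) * (geo9K i).len a ^ 4 * Real.exp (-(aD * δ₀ * (geo9K i).dist a a''))))
    (hEd : ∀ c, HasMajorant (g := toB6 (geo9K i) Rr Hp) (fun p : BlkY i × ι => ιB p.1) (conj b (E c))
      (fun a a' => κE * Real.exp (-(aX * δ₀ * DsepT i)) * Real.exp (-(aE * δ₀ * (geo9K i).dist a a')))) :
    HasMajorant (g := toB6 (geo9K i) Rr Hp) (fun p : BlkY i × ι => ιB p.1)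
      (conj b ((etaS i ^ 2 * etaS i ^ 2)⁻¹ • (XinvY i parS O (cfg U₁)).restrictScalars ℝ))
      (fun a a' => (3 * 5 ^ (d + 1)) * B₀ * B6.c1 d' (ρ * δ₀) α' * (1 - (θ₁ + θ₂ + θ₃ + θ₄) * B6.c1 d' (ρ * δ₀) α')⁻¹ * ((geo9K i).len a ^ 4)⁻¹ *
        Real.exp (-((1 - α') * (ρ * δ₀) * (geo9K i).dist a a'))) := by
  obtain ⟨htri, hrefl, hsymm, hdnn⟩ := geo9K_basic i (Rr := Rr) (Hp := Hp)
  have hη : etaS i ^ 2 * etaS i ^ 2 ≠ 0 := ne_of_gt (mul_pos (pow_pos (etaS_pos i) 2) (pow_pos (etaS_pos i) 2))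
  -- the localized [2]-difference at FILE 9b's indicator cut-offs `1_{S^χ_□}∘ιB = 1_{□̃}`, `1_{S_□}∘ιB = 1_{□⁺}`
  have hD' : ∀ c, HasMajorant (g := toB6 (geo9K i) Rr Hp) (fun p : BlkY i × ι => ιB p.1)
      (conj b ((etaS i ^ 2 * etaS i ^ 2) • ((cutMulY (𝔸 := 𝔸) (fun t : BlkY i => if ιB t ∈ SQbigT i c then (1 : ℝ) else 0)).restrictScalars ℝ *
        ((XY i parS O (cfg U₁)).restrictScalars ℝ - (XY i parS (Oc c) (cfg U₁)).restrictScalars ℝ) *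
        (cutMulY (𝔸 := 𝔸) (fun t : BlkY i => if ιB t ∈ SQT i c then (1 : ℝ) else 0)).restrictScalars ℝ)))
      (fun a a'' => κD * Real.exp (-(2 * δ₀ * DsepT i)) * (geo9K i).len a ^ 4 * Real.exp (-(aD * δ₀ * (geo9K i).dist a a''))) := fun c => by
    rw [indicator_SQbigT_eq i ιB hι c, indicator_SQT_eq i ιB hι c]
    exact hD c
  exact hasMajorant_conj_XinvY_of_eBlockInv_loc_defect i b ιB cfg O parS Oc hE hEc hBG hι hunit hpar hM₂ hrepr d' d₂ hCG hαGδ hα₂0 hα₂1 hδG hSTG h261G hrate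
    (fun c => SQbigT i c) (fun c => SQT i c) (fun c => chiBigT i c) (fun c => hB i.D c) Cl E (mul_inv_cancel₀ hη) hκD hκE le_rfl (lipT_nonneg i) hB₀ hC0
    (by positivity) hδ₀ hasep hρ hρb hρE hαc hα'1 hsplit₁ hsplit₂ hsplit₃ hκG hθ₁ hθ₂ (by rw [zero_add]; exact hθ₃) hθ₄ htri hrefl hsymm hdnn hST h261b h261
    h263 hsmall (sum_hB_sq_blk i) (abs_hB_le i) (hS_cover i ιB hι) (hcnt_SQT i) (chiBigT_01 i) (chiBigT_eq_one i ιB hι) (chiBigT_supp i ιB hι)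
    (hsep_cover i) (hLip_cover i ιB hι) hdef hC hD' hEd

/-- ★★★ **THEOREM 3.2 (3.48) FOR `C(U)` POINTWISE AT THE CUBE COVER OF RECORD** («|(Q′(U)G′²(U)Q′*(U))⁻¹(y, y′)| ≦ B₀(Lʲη)⁻⁴(L^{j′}η)^{−d}e^{−δ₀d(y,y′)}», constant and rate
explicit, in def-Y's lattice units with the scale weight `(η²η²)⁻¹`): under the hypotheses of `hasMajorant_conj_XinvY_of_eBlockInv_cover_defect`, every source `λ` supported at
one block `s₀` with `‖λ(s₀)‖ ≦ 1` obeys `(η²η²)⁻¹·‖(XinvY i parS O U λ)(t)‖ ≦ (Σ_j‖b_j‖)M₂·[3·5^{d+1}B₀c₁(ρδ₀,α′)(1 − (θ₁+θ₂+θ₃+θ₄)c₁)⁻¹]·ℓ(ιB t)⁻⁴·e^{−(1−α′)ρδ₀·d(ιB t, ιB s₀)}`.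
[cite: Balaban1985BackgroundPropagators, Thm 3.2 (3.48) p.398 via Thm 3.9 p.413 + Thm 3.1 (3.42) p.397; Balaban1984PropagatorsII, (2.51) p.232] -/
theorem norm_XinvY_apply_of_eBlockInv_cover_defect (Oc : ↥(cubes i.D.toDomains) → SiteOpY 𝔸 i)
    {BG δG : ℝ} (hE : EBlock (kernelFamilySInv i B cfg O parS) BG δG U₁) (hEc : ∀ c, EBlock (kernelFamilySInv i B cfg (Oc c) parS) BG δG U₁)
    (hBG : 0 ≤ BG) (hι : ∀ s, β i.hN i.D i.hk (ιB s) = s)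
    (hunit : IsUnit (XY i parS O (cfg U₁)))
    (hpar : ∀ z w : SiteY i, ‖(parS (cfg U₁) z w : 𝔸)‖ ≤ 1 ∧ ‖(((parS (cfg U₁) z w)⁻¹ : 𝔸ˣ) : 𝔸)‖ ≤ 1)
    {M₂ : ℝ} (hM₂ : 0 ≤ M₂) (hrepr : ∀ (v : 𝔸) (j : ι), |b.repr v j| ≤ M₂ * ‖v‖) (d' d₂ : ℕ)
    {αG α₂ CG : ℝ} (hCG : 0 ≤ CG) (hαGδ : 0 ≤ αG * δG) (hα₂0 : 0 ≤ α₂) (hα₂1 : α₂ ≤ 1) (hδG : 0 ≤ (1 - αG) * δG)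
    (hSTG : B9Ineq347.ScaleTransfer (geo9K i) δG αG CG (fun a => (geo9K i).len a ^ 2))
    (h261G : Ineq261 d₂ (toB6 (geo9K i) Rr Hp) ((1 - αG) * δG) α₂)
    {δ₀ aL aD aE aX αc αst asep ρ bb κG κD κE B₀ C α' θ₁ θ₂ θ₃ θ₄ : ℝ} (hrate : aL * δ₀ ≤ (1 - α₂) * ((1 - αG) * δG))
    (Cl E : ↥(cubes i.D.toDomains) → Module.End ℝ (BlkY i → 𝔸))
    (hκD : 0 ≤ κD) (hκE : 0 ≤ κE) (hB₀ : 0 ≤ B₀) (hC0 : 0 ≤ C)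
    (hδ₀ : 0 ≤ δ₀) (hasep : 0 ≤ asep) (hρ : 0 ≤ ρ) (hρb : ρ ≤ bb) (hρE : ρ ≤ aE) (hαc : 0 < αc * δ₀) (hα'1 : α' ≤ 1)
    (hsplit₁ : αst + asep + ρ ≤ aL) (hsplit₂ : αst + ρ ≤ aD) (hsplit₃ : αst + αc + ρ ≤ aL)
    (hκG : κG = (M₂ * (∑ j, ‖b j‖) * BG) ^ 2 * CG * B6.c1 d₂ ((1 - αG) * δG) α₂)
    (hθ₁ : θ₁ = (3 * 5 ^ (d + 1)) * (((M₂ * ∑ j, ‖b j‖) ^ 2 * κG) * B₀ * C * B6.c1 d' δ₀ (bb - ρ) * Real.exp (-(asep * δ₀ * DsepT i))))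
    (hθ₂ : θ₂ = (3 * 5 ^ (d + 1)) * (κD * Real.exp (-(2 * δ₀ * DsepT i)) * B₀ * C * B6.c1 d' δ₀ (bb - ρ)))
    (hθ₃ : θ₃ = (3 * 5 ^ (d + 1)) * ((lipT i * (αc * δ₀)⁻¹) * ((M₂ * ∑ j, ‖b j‖) ^ 2 * κG) * B₀ * C * B6.c1 d' δ₀ (bb - ρ)))
    (hθ₄ : θ₄ = (3 * 5 ^ (d + 1)) * (κE * Real.exp (-(aX * δ₀ * DsepT i))))
    (hST : B9Ineq347.ScaleTransfer (geo9K i) δ₀ αst C (fun a => ((geo9K i).len a ^ 4)⁻¹)) (h261b : Ineq261 d' (toB6 (geo9K i) Rr Hp) δ₀ (bb - ρ))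
    (h261 : Ineq261 d' (toB6 (geo9K i) Rr Hp) (ρ * δ₀) α') (h263 : Ineq263 d' (toB6 (geo9K i) Rr Hp) (ρ * δ₀) α')
    (hsmall : (θ₁ + θ₂ + θ₃ + θ₄) * B6.c1 d' (ρ * δ₀) α' < 1)
    (hdef : ∀ c, (cutMulY (𝔸 := 𝔸) (hB i.D c)).restrictScalars ℝ *
      ((cutMulY (𝔸 := 𝔸) (chiBigT i c)).restrictScalars ℝ * (XY i parS (Oc c) (cfg U₁)).restrictScalars ℝ) * Cl c *
        (cutMulY (𝔸 := 𝔸) (hB i.D c)).restrictScalars ℝ =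
      (cutMulY (𝔸 := 𝔸) (hB i.D c)).restrictScalars ℝ * (cutMulY (𝔸 := 𝔸) (hB i.D c)).restrictScalars ℝ + E c)
    (hC : ∀ c, HasMajorant (g := toB6 (geo9K i) Rr Hp) (fun p : BlkY i × ι => ιB p.1) (conj b ((etaS i ^ 2 * etaS i ^ 2)⁻¹ • Cl c))
      (fun a a' => B₀ * ((geo9K i).len a ^ 4)⁻¹ * Real.exp (-(bb * δ₀ * (geo9K i).dist a a'))))
    (hD : ∀ c, HasMajorant (g := toB6 (geo9K i) Rr Hp) (fun p : BlkY i × ι => ιB p.1)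
      (conj b ((etaS i ^ 2 * etaS i ^ 2) • ((cutMulY (𝔸 := 𝔸) (chiBigT i c)).restrictScalars ℝ *
        ((XY i parS O (cfg U₁)).restrictScalars ℝ - (XY i parS (Oc c) (cfg U₁)).restrictScalars ℝ) *
        (cutMulY (𝔸 := 𝔸) (cubeIndT i.D (one_le_Mh i) (four_le_P' i) c)).restrictScalars ℝ)))
      (fun a a'' => κD * Real.exp (-(2 * δ₀ * DsepT i)) * (geo9K i).len a ^ 4 * Real.exp (-(aD * δ₀ * (geo9K i).dist a a''))))
    (hEd : ∀ c, HasMajorant (g := toB6 (geo9K i) Rr Hp) (fun p : BlkY i × ι => ιB p.1) (conj b (E c))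
      (fun a a' => κE * Real.exp (-(aX * δ₀ * DsepT i)) * Real.exp (-(aE * δ₀ * (geo9K i).dist a a'))))
    (lam : BlkY i → 𝔸) (s₀ : BlkY i) (hsupp : ∀ t, t ≠ s₀ → lam t = 0) (hbd : ‖lam s₀‖ ≤ 1) (t : BlkY i) :
    (etaS i ^ 2 * etaS i ^ 2)⁻¹ * ‖XinvY i parS O (cfg U₁) lam t‖ ≤
      (∑ j, ‖b j‖) * M₂ * ((3 * 5 ^ (d + 1)) * B₀ * B6.c1 d' (ρ * δ₀) α' * (1 - (θ₁ + θ₂ + θ₃ + θ₄) * B6.c1 d' (ρ * δ₀) α')⁻¹) *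
      ((geo9K i).len (ιB t) ^ 4)⁻¹ * Real.exp (-((1 - α') * (ρ * δ₀) * (geo9K i).dist (ιB t) (ιB s₀))) := by
  have hmaj := hasMajorant_conj_XinvY_of_eBlockInv_cover_defect i b cfg O parS ιB (Rr := Rr) (Hp := Hp) Oc hE hEc hBG hι hunit hpar hM₂ hrepr d' d₂ hCG hαGδ
    hα₂0 hα₂1 hδG hSTG h261G hrate Cl E hκD hκE hB₀ hC0 hδ₀ hasep hρ hρb hρE hαc hα'1 hsplit₁ hsplit₂ hsplit₃ hκG hθ₁ hθ₂ hθ₃ hθ₄ hST h261b h261 h263 hsmall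
    hdef hC hD hEd
  have hs0 : 0 ≤ (etaS i ^ 2 * etaS i ^ 2)⁻¹ := inv_nonneg.mpr (mul_nonneg (sq_nonneg _) (sq_nonneg _))
  have hw := norm_apply_le_of_hasMajorant_blk i b ιB ((etaS i ^ 2 * etaS i ^ 2)⁻¹ • (XinvY i parS O (cfg U₁)).restrictScalars ℝ) hM₂ hrepr hmaj lam s₀
    zero_le_one hsupp hbd t
  rw [LinearMap.smul_apply, Pi.smul_apply, LinearMap.restrictScalars_apply, norm_smul, Real.norm_eq_abs, abs_of_nonneg hs0] at hw
  exact hw.trans (le_of_eq (by ring))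

end Main


end Cover

/-! ## §2 ★★★ For every member above ONE threshold: the geometry discharged (FILE 12 twin) -/

section Above

/-- ★★★ **THEOREM 3.9 ⇒ THEOREM 3.2 (3.48) FOR `C(U) = (Q′G′²Q′*)⁻¹(U)` AT THE CUBE COVER OF RECORD, FOR EVERY MEMBER ABOVE ONE THRESHOLD** («For M sufficiently large …
This theorem implies Theorem 3.2»): for rate data `α_Gδ_G > 0`, `0 < α₂ ≦ 1`, `(1−α_G)δ_G > 0`, `δ₀ > 0`, `0 < ρ < b`, `0 < α′ ≦ 1`, `α_st > 0` there are a threshold `M_L`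
and exponents `d₂`, `d′` such that for every member `i` with `M_L ≦ M_i` FILE 10's statement holds with its geometric binders discharged ([4] Lemma 2.1 at the three
rate pairs, (2.63), the scale transfers of `ℓ²`/`ℓ⁻⁴` with constants `L²`/`L⁴`): from M5.5's `EBlock`s of `G′ = O` and of the `G′_□ = Oc □`, `IsUnit XY`, contractive
transporters, the coordinate bound, the per-cube `hdef`/`hEd` (local-inverse law up to the displayed defect, E1-1)/`hC`/localized `hD` at the cover of record, the rate bookkeeping and the located smallness,
`conj b ((η²η²)⁻¹•XinvY i parS O U) ≺ 3·5^{d+1}B₀c₁(d′,ρδ₀,α′)(1 − (θ₁+θ₂+θ₃+θ₄)c₁(d′,ρδ₀,α′))⁻¹·ℓ(a)⁻⁴·e^{−(1−α′)ρδ₀d(a,a′)}`.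
[cite: Balaban1985BackgroundPropagators, Thm 3.9 p.413 + Thm 3.2 (3.48) p.398 + p.398 (scale transfer) + (3.95)–(3.97) pp.411–412 + p.408;
Balaban1984PropagatorsII, Lemma 2.1 (2.59)–(2.61), (2.63) pp.233–234 + (2.83)–(2.85) pp.237–238] -/
theorem cinv_cover_above_defect [∀ i' : KIdx d ℓ hd hL b₀ b₁, Fintype (geo9K i').Site] [∀ i' : KIdx d ℓ hd hL b₀ b₁, DecidableEq (geo9K i').Site]
    (Rr : KIdx d ℓ hd hL b₀ b₁ → ℝ) (Hp : KIdx d ℓ hd hL b₀ b₁ → Prop) (b : Module.Basis ι ℝ 𝔸)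
    {M₂ : ℝ} (hM₂ : 0 ≤ M₂) (hrepr : ∀ (v : 𝔸) (j : ι), |b.repr v j| ≤ M₂ * ‖v‖)
    {δG αG α₂ δ₀ αst bb ρ α' : ℝ} (hαGδ : 0 < αG * δG) (hα₂0 : 0 < α₂) (hα₂1 : α₂ ≤ 1) (hδG : 0 < (1 - αG) * δG)
    (hδ₀ : 0 < δ₀) (hρ : 0 < ρ) (hρb : ρ < bb) (hα'0 : 0 < α') (hα'1 : α' ≤ 1) (hαst : 0 < αst) :
    ∃ (ML : ℝ) (d₂ d' : ℕ), ∀ i : KIdx d ℓ hd hL b₀ b₁, ML ≤ (geo9K i).M →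
      ∀ {B : B9.Backgrounds} (cfg : B.Cfg → CfgY 𝔸 i) (O : SiteOpY 𝔸 i) (parS : SiteParY 𝔸 i) {U₁ : B.Cfg} (ιB : BlkY i → IBondY i)
        (Oc : ↥(cubes i.D.toDomains) → SiteOpY 𝔸 i) {BG : ℝ}
        (hE : EBlock (kernelFamilySInv i B cfg O parS) BG δG U₁) (hEc : ∀ c, EBlock (kernelFamilySInv i B cfg (Oc c) parS) BG δG U₁)
        (hBG : 0 ≤ BG) (hι : ∀ s, β i.hN i.D i.hk (ιB s) = s)
        (hunit : IsUnit (XY i parS O (cfg U₁)))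
        (hpar : ∀ z w : SiteY i, ‖(parS (cfg U₁) z w : 𝔸)‖ ≤ 1 ∧ ‖(((parS (cfg U₁) z w)⁻¹ : 𝔸ˣ) : 𝔸)‖ ≤ 1)
        (Cl E : ↥(cubes i.D.toDomains) → Module.End ℝ (BlkY i → 𝔸))
        {aL aD aE aX αc asep κG κD κE B₀ θ₁ θ₂ θ₃ θ₄ : ℝ} (hrate : aL * δ₀ ≤ (1 - α₂) * ((1 - αG) * δG))
        (hκD : 0 ≤ κD) (hκE : 0 ≤ κE) (hB₀ : 0 ≤ B₀) (hasep : 0 ≤ asep) (hρE : ρ ≤ aE) (hαc : 0 < αc * δ₀)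
        (hsplit₁ : αst + asep + ρ ≤ aL) (hsplit₂ : αst + ρ ≤ aD) (hsplit₃ : αst + αc + ρ ≤ aL)
        (hκG : κG = (M₂ * (∑ j, ‖b j‖) * BG) ^ 2 * ((ℓ : ℝ) + 1) ^ 2 * B6.c1 d₂ ((1 - αG) * δG) α₂)
        (hθ₁ : θ₁ = (3 * 5 ^ (d + 1)) * (((M₂ * ∑ j, ‖b j‖) ^ 2 * κG) * B₀ * ((ℓ : ℝ) + 1) ^ 4 * B6.c1 d' δ₀ (bb - ρ) *
          Real.exp (-(asep * δ₀ * DsepT i))))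
        (hθ₂ : θ₂ = (3 * 5 ^ (d + 1)) * (κD * Real.exp (-(2 * δ₀ * DsepT i)) * B₀ * ((ℓ : ℝ) + 1) ^ 4 * B6.c1 d' δ₀ (bb - ρ)))
        (hθ₃ : θ₃ = (3 * 5 ^ (d + 1)) * ((lipT i * (αc * δ₀)⁻¹) * ((M₂ * ∑ j, ‖b j‖) ^ 2 * κG) * B₀ * ((ℓ : ℝ) + 1) ^ 4 * B6.c1 d' δ₀ (bb - ρ)))
        (hθ₄ : θ₄ = (3 * 5 ^ (d + 1)) * (κE * Real.exp (-(aX * δ₀ * DsepT i))))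
        (hsmall : (θ₁ + θ₂ + θ₃ + θ₄) * B6.c1 d' (ρ * δ₀) α' < 1)
        (hdef : ∀ c, (cutMulY (𝔸 := 𝔸) (hB i.D c)).restrictScalars ℝ *
          ((cutMulY (𝔸 := 𝔸) (chiBigT i c)).restrictScalars ℝ * (XY i parS (Oc c) (cfg U₁)).restrictScalars ℝ) * Cl c *
            (cutMulY (𝔸 := 𝔸) (hB i.D c)).restrictScalars ℝ =
          (cutMulY (𝔸 := 𝔸) (hB i.D c)).restrictScalars ℝ * (cutMulY (𝔸 := 𝔸) (hB i.D c)).restrictScalars ℝ + E c)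
        (hC : ∀ c, HasMajorant (g := toB6 (geo9K i) (Rr i) (Hp i)) (fun p : BlkY i × ι => ιB p.1) (conj b ((etaS i ^ 2 * etaS i ^ 2)⁻¹ • Cl c))
          (fun a a' => B₀ * ((geo9K i).len a ^ 4)⁻¹ * Real.exp (-(bb * δ₀ * (geo9K i).dist a a'))))
        (hD : ∀ c, HasMajorant (g := toB6 (geo9K i) (Rr i) (Hp i)) (fun p : BlkY i × ι => ιB p.1)
          (conj b ((etaS i ^ 2 * etaS i ^ 2) • ((cutMulY (𝔸 := 𝔸) (chiBigT i c)).restrictScalars ℝ *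
            ((XY i parS O (cfg U₁)).restrictScalars ℝ - (XY i parS (Oc c) (cfg U₁)).restrictScalars ℝ) *
            (cutMulY (𝔸 := 𝔸) (cubeIndT i.D (one_le_Mh i) (four_le_P' i) c)).restrictScalars ℝ)))
          (fun a a'' => κD * Real.exp (-(2 * δ₀ * DsepT i)) * (geo9K i).len a ^ 4 * Real.exp (-(aD * δ₀ * (geo9K i).dist a a''))))
        (hEd : ∀ c, HasMajorant (g := toB6 (geo9K i) (Rr i) (Hp i)) (fun p : BlkY i × ι => ιB p.1) (conj b (E c))
          (fun a a' => κE * Real.exp (-(aX * δ₀ * DsepT i)) * Real.exp (-(aE * δ₀ * (geo9K i).dist a a')))),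
        HasMajorant (g := toB6 (geo9K i) (Rr i) (Hp i)) (fun p : BlkY i × ι => ιB p.1)
          (conj b ((etaS i ^ 2 * etaS i ^ 2)⁻¹ • (XinvY i parS O (cfg U₁)).restrictScalars ℝ))
          (fun a a' => (3 * 5 ^ (d + 1)) * B₀ * B6.c1 d' (ρ * δ₀) α' * (1 - (θ₁ + θ₂ + θ₃ + θ₄) * B6.c1 d' (ρ * δ₀) α')⁻¹ * ((geo9K i).len a ^ 4)⁻¹ *
            Real.exp (-((1 - α') * (ρ * δ₀) * (geo9K i).dist a a'))) := by
  -- [4] Lemma 2.1 at the three rate pairs (FILE 11), pairs 2 and 3 at the common exponent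
  have h₁ : 0 < α₂ * ((1 - αG) * δG) := mul_pos hα₂0 hδG
  have h₂ : 0 < (bb - ρ) * δ₀ := mul_pos (sub_pos.mpr hρb) hδ₀
  have h₃ : 0 < α' * (ρ * δ₀) := mul_pos hα'0 (mul_pos hρ hδ₀)
  obtain ⟨ML₀, hgeo⟩ := geo_inputs3_geo9K Rr Hp h₁ h₂ h₃ (mul_pos hρ hδ₀).le hα'1
  have hlog : 0 ≤ Real.log ((ℓ : ℝ) + 1) := Real.log_nonneg (by linarith [(Nat.cast_nonneg ℓ : (0 : ℝ) ≤ ℓ)])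
  have hst : 0 < αst * δ₀ := mul_pos hαst hδ₀
  refine ⟨max ML₀ (max (2 * Real.log ((ℓ : ℝ) + 1) / (αG * δG)) (4 * Real.log ((ℓ : ℝ) + 1) / (αst * δ₀))),
    exp261 (geo9K (d := d) (ℓ := ℓ) (hd := hd) (hL := hL) (b₀ := b₀) (b₁ := b₁)) ((1 - αG) * δG) α₂,
    max (exp261 (geo9K (d := d) (ℓ := ℓ) (hd := hd) (hL := hL) (b₀ := b₀) (b₁ := b₁)) δ₀ (bb - ρ))
      (exp261 (geo9K (d := d) (ℓ := ℓ) (hd := hd) (hL := hL) (b₀ := b₀) (b₁ := b₁)) (ρ * δ₀) α'), fun i hM => ?_⟩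
  intro B cfg O parS U₁ ιB Oc BG hE hEc hBG hι hunit hpar Cl E aL aD aE aX αc asep κG κD κE B₀ θ₁ θ₂ θ₃ θ₄ hrate hκD hκE hB₀ hasep hρE hαc hsplit₁ hsplit₂
    hsplit₃ hκG hθ₁ hθ₂ hθ₃ hθ₄ hsmall hdef hC hD hEd
  obtain ⟨htri, hrefl, hsymm, hdnn, h261G, h261b, h261, h263⟩ := hgeo i ((le_max_left _ _).trans hM)
  -- the two p. 398 scale transfers from the explicit size conditions folded into the threshold
  have hMG : 2 * Real.log ((ℓ : ℝ) + 1) ≤ αG * δG * (2 * ((ℓ : ℝ) + 1) ^ 2 - 1) * (geo9K i).M :=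
    size_of_threshold hαGδ (by positivity) (((le_max_left _ _).trans (le_max_right _ _)).trans hM)
  have hMst : 4 * Real.log ((ℓ : ℝ) + 1) ≤ αst * δ₀ * (2 * ((ℓ : ℝ) + 1) ^ 2 - 1) * (geo9K i).M :=
    size_of_threshold hst (by positivity) (((le_max_right _ _).trans (le_max_right _ _)).trans hM)
  have hSTG := scaleTransfer_len_sq_geo9K i hαGδ hMG
  have hST := scaleTransfer_len_inv4_geo9K i hst hMst
  exact hasMajorant_conj_XinvY_of_eBlockInv_cover_defect i b cfg O parS ιB (Rr := Rr i) (Hp := Hp i) Oc hE hEc hBG hι hunit hpar hM₂ hrepr _ _ (by positivity)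
    hαGδ.le hα₂0.le hα₂1 hδG.le hSTG h261G hrate Cl E hκD hκE hB₀ (by positivity) hδ₀.le hasep hρ.le hρb.le hρE hαc hα'1 hsplit₁ hsplit₂ hsplit₃ hκG hθ₁
    hθ₂ hθ₃ hθ₄ hST h261b h261 h263 hsmall hdef hC hD hEd


end Above

end Literature.MathematicalPhysics.QuantumFieldTheory.Balaban1983to89.B9Thm39CinvAtCoverDefect

end
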